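import Summits.Ventures.PercRepro.C041ZoneOCubeSkel

/-!
# (O-CUBE) is the ZONE O-CUBE of the skeleton zone — side `b`, the weights, the sums (p6, gen 27; C-041.md §14 (a))

Setting of `C041ZoneOCubeSkel`.  Side `b` by the mirror of side `a`: `D2` is «attached to `b`» (`skel_not_mem_cluster_b_iff`),
a red bare walk avoiding the blue cluster of `b` ends in `REACH2 {c}` and conversely
(`skel_mem_REACH2_singleton_of_bareWalkAvoiding`, `skel_walk_of_mem_REACH2_singleton`), so **`Good_b ⟺ G2`**
(`skel_G2_iff`, through `exists_bareWalkAvoiding_of_goodA` on the mirrored skeleton `(G; b, a, c)`).  Validity: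
`K {c} = K(S)` (`skel_K_singleton_eq`) and `Valid {c} ⟺ ¬ RcInvalid` (`skel_valid_iff`).  Hence on the valid cube
states `gdWeight = ocWeight` (`gdWeight_eq_ocWeight`), on the invalid ones `ocWeight = 0`, and the O-cube sum is the
ZONE O-CUBE sum of the skeleton zone (`oCube_eq_zoneOCubeF`, through the bijection `toState` between the cube states
and the forced admissible states with `Γ`).

* **`oCubeConj_iff_zoneOCube`** — CONJECTURE (O-CUBE) for `(G; a, b, c)` ⟺ the ZONE O-CUBE conjecture on the
  skeleton zones `skelZone a b O` with anchor `c` and protected anchor `c`, for every `O`.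
-/

namespace PercRepro

namespace MultiGraph

open Finset ZoneZ ZoneZ.ZoneData

variable {V E : Type*} {G : MultiGraph V E} {a b c : V}

section SideB

variable (hc : c ≠ a ∧ c ≠ b) (O S : Config E)

include hc

omit hc in
/-- For an admissible state a non-terminal lies outside the blue cluster of `b` iff it is not deleted on side `2`. -/
theorem skel_not_mem_cluster_b_iff (hadm : ¬ G.Conn Sᶜ a b) {v : V} (hv : v ≠ a ∧ v ≠ b) :
    v ∉ G.cluster Sᶜ b ↔ v ∉ (G.skelZone a b O).D2 (G.toState a b S) := by
  rw [mem_cluster_compl_iff_attached' a b hadm hv]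
  unfold ZoneData.D2
  rw [skel_mem_reach_M_iff O S hv]

/-- A red bare walk from the probe avoiding the blue cluster of `b` ends in `REACH2 {c}`. -/
theorem skel_mem_REACH2_singleton_of_bareWalkAvoiding (hadm : ¬ G.Conn Sᶜ a b)
    (hcD : c ∉ (G.skelZone a b O).D2 (G.toState a b S)) {w : V}
    (hw : Relation.ReflTransGen (fun x y => G.BareAdj a b S x y ∧ y ∉ G.cluster Sᶜ b) c w) :
    w ∈ (G.skelZone a b O).REACH2 {c} (G.toState a b S) := by
  unfold ZoneData.REACH2 ZoneData.reachIn
  induction hw with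
  | refl => exact mem_reach_of_mem ⟨rfl, hcD⟩
  | tail hpre hxy ih =>
    have hx' := ne_terminal_of_bareReach (bareWalk_of_avoiding a b hpre) hc
    have hy' := ne_terminal_of_bareReach (bareWalk_of_avoiding a b (hpre.tail hxy)) hc
    have hyD : _ ∉ (G.skelZone a b O).D2 (G.toState a b S) :=
      (skel_not_mem_cluster_b_iff O S hadm hy').1 hxy.2
    exact reach_tail ih ⟨(skel_redAdj_iff O S hx').2 hxy.1, reachIn_subset ih, hyD⟩

/-- The vertices of `REACH2 {c}` are non-terminals red-reached from the probe avoiding the blue cluster of `b`. -/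
theorem skel_walk_of_mem_REACH2_singleton (hadm : ¬ G.Conn Sᶜ a b) {w : V}
    (hw : w ∈ (G.skelZone a b O).REACH2 {c} (G.toState a b S)) :
    Relation.ReflTransGen (fun x y => G.OpenAdj S x y ∧ y ∉ G.cluster Sᶜ b) c w ∧ (w ≠ a ∧ w ≠ b) := by
  obtain ⟨s, ⟨hs, _⟩, h⟩ := hw
  rw [Set.mem_singleton_iff] at hs
  subst hs
  induction h with
  | refl => exact ⟨Relation.ReflTransGen.refl, hc⟩
  | tail _ hxy ih =>
    obtain ⟨hxy, _, hyD⟩ := hxy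
    have hxy' := (skel_redAdj_iff O S ih.2).1 hxy
    have hy' : _ ≠ a ∧ _ ≠ b := (ne_of_bare_joins hxy'.choose_spec.1 hxy'.choose_spec.2.2).2
    exact ⟨ih.1.tail ⟨hxy'.openAdj, (skel_not_mem_cluster_b_iff O S hadm hy').2 hyD⟩, hy'⟩

/-- **`Good_b` is `G2`** on the skeleton zone with anchor `c`, for an admissible state. -/
theorem skel_G2_iff (hadm : ¬ G.Conn Sᶜ a b) :
    (G.skelZone a b O).G2 {c} (G.toState a b S) ↔ G.WalkAvoiding S (G.cluster Sᶜ b) c a := by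
  constructor
  · rintro ⟨w, hwR, hwBlt⟩
    obtain ⟨hwalk, hw'⟩ := skel_walk_of_mem_REACH2_singleton hc O S hadm hwR
    obtain ⟨_, e, hj, hSe⟩ := (skel_mem_Blt_iff O S w).1 hwBlt
    have hcD : c ∉ G.cluster Sᶜ b := by
      obtain ⟨s, ⟨hs, hsD⟩, _⟩ := hwR
      rw [Set.mem_singleton_iff] at hs
      subst hs
      exact (skel_not_mem_cluster_b_iff O S hadm hc).2 hsD
    refine ⟨hcD, hwalk.tail ⟨⟨e, hSe, hj⟩, ?_⟩⟩
    rw [mem_cluster]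
    intro h
    exact hadm h.symm
  · intro hg
    obtain ⟨w, hw, _, e, hSe, hj⟩ := exists_bareWalkAvoiding_of_goodA b a c ⟨hc.2, hc.1⟩ hg
    rw [bareAdj_comm a b S] at hw
    have hw' : w ≠ a ∧ w ≠ b := ne_terminal_of_bareReach (bareWalk_of_avoiding a b hw) hc
    have hcD : c ∉ (G.skelZone a b O).D2 (G.toState a b S) := (skel_not_mem_cluster_b_iff O S hadm hc).1 hg.1
    exact ⟨w, skel_mem_REACH2_singleton_of_bareWalkAvoiding hc O S hadm hcD hw,
      (skel_mem_Blt_iff O S w).2 ⟨hw', e, hj, hSe⟩⟩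

end SideB

section Weight

variable [Fintype V] [Fintype E] [DecidableEq E] (hc : c ≠ a ∧ c ≠ b) (O S : Config E)

include hc

omit [Fintype V] [Fintype E] [DecidableEq E] in
/-- `K` with the single anchor `c` is `K(S)`. -/
theorem skel_K_singleton_eq : (G.skelZone a b O).K {c} (G.toState a b S) = G.BareReach a b c S := by
  ext v
  unfold ZoneData.K
  rw [skel_mem_reach_red_iff O S (S' := {c}) (fun s hs => by
    rw [Set.mem_singleton_iff] at hs
    exact hs ▸ hc)]
  constructor
  · rintro ⟨s, hs, hsv⟩
    rw [Set.mem_singleton_iff] at hs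
    subst hs
    exact hsv
  · intro h
    exact ⟨c, rfl, h⟩

/-- `Valid {c}` is validity, for a cube state with an edge between the terminals. -/
theorem skel_valid_iff (hab : ∃ e, G.Joins e a b) (hS : G.IsCubeState a b c O S) :
    (G.skelZone a b O).Valid {c} (G.toState a b S) ↔ ¬ G.RcInvalid a b c S := by
  unfold ZoneData.Valid ZoneData.blueK
  rw [skel_K_singleton_eq hc O S, rcInvalid_iff a b c hc hab hS]
  constructor
  · intro h h'
    apply h
    rw [Set.disjoint_left]
    intro w hw hw'
    rcases hw' with hw' | hw'
    · obtain ⟨_, e, hj, hSe⟩ := (skel_mem_Blt_iff O S w).1 hw'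
      rw [h' w hw e (Or.inl hj)] at hSe
      exact absurd hSe (by decide)
    · obtain ⟨_, e, hj, hSe⟩ := (skel_mem_Mt_iff O S w).1 hw'
      rw [h' w hw e (Or.inr hj)] at hSe
      exact absurd hSe (by decide)
  · intro h h'
    apply h
    intro w hw e hj
    by_contra hSe
    have hSe' : S e = true := by
      cases h'' : S e
      · exact absurd h'' hSe
      · rfl
    have hw' := ne_terminal_of_bareReach hw hc
    refine Set.disjoint_left.1 h' hw ?_
    rcases hj with hj | hj
    · exact Or.inl ((skel_mem_Blt_iff O S w).2 ⟨hw', e, hj, hSe'⟩)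
    · exact Or.inr ((skel_mem_Mt_iff O S w).2 ⟨hw', e, hj, hSe'⟩)

open Classical in
/-- On a valid cube state the weight of gen 24 is the zone weight. -/
theorem gdWeight_eq_ocWeight (hab : ∃ e, G.Joins e a b) (hS : G.IsCubeState a b c O S)
    (hvalid : ¬ G.RcInvalid a b c S) : G.gdWeight a b c S = (G.skelZone a b O).ocWeight {c} (G.toState a b S) := by
  have hadm : ¬ G.Conn Sᶜ a b := hS.2.2.2.2
  unfold gdWeight ZoneData.ocWeight
  rw [if_pos ((skel_valid_iff hc O S hab hS).2 hvalid)]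
  by_cases h1 : G.WalkAvoiding S (G.cluster Sᶜ a) c b <;>
    by_cases h2 : G.WalkAvoiding S (G.cluster Sᶜ b) c a
  · rw [if_pos h1, if_pos h2, if_pos ((skel_G1_iff hc O S hS).2 h1), if_pos ((skel_G2_iff hc O S hadm).2 h2)]
    norm_num
  · rw [if_pos h1, if_neg h2, if_pos ((skel_G1_iff hc O S hS).2 h1),
      if_neg (fun h => h2 ((skel_G2_iff hc O S hadm).1 h))]
    norm_num
  · rw [if_neg h1, if_pos h2, if_neg (fun h => h1 ((skel_G1_iff hc O S hS).1 h)),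
      if_pos ((skel_G2_iff hc O S hadm).2 h2)]
    norm_num
  · rw [if_neg h1, if_neg h2, if_neg (fun h => h1 ((skel_G1_iff hc O S hS).1 h)),
      if_neg (fun h => h2 ((skel_G2_iff hc O S hadm).1 h))]
    norm_num

open Classical in
/-- On an invalid cube state the zone weight vanishes. -/
theorem ocWeight_eq_zero_of_invalid (hab : ∃ e, G.Joins e a b) (hS : G.IsCubeState a b c O S)
    (hinv : G.RcInvalid a b c S) : (G.skelZone a b O).ocWeight {c} (G.toState a b S) = 0 := by
  unfold ZoneData.ocWeight
  rw [if_neg (fun h => (skel_valid_iff hc O S hab hS).1 h hinv)]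

end Weight

section Sums

variable [Fintype V] [Fintype E] [DecidableEq E] (hc : c ≠ a ∧ c ≠ b) (hne : a ≠ b) (hab : ∃ e, G.Joins e a b)
  (O : Config E)

include hc hne hab

open Classical in
/-- **The O-cube sum is the ZONE O-CUBE sum of the skeleton zone** with anchor `c` and protected anchor `c`. -/
theorem oCube_eq_zoneOCubeF : G.oCube a b c O = (G.skelZone a b O).zoneOCubeF {c} {c} := by
  rw [oCube_eq_sum_valid_cube O, Finset.sum_filter]
  unfold FZone.zoneOCubeF
  refine Finset.sum_nbij' (G.toState a b) (G.ofState a b) ?_ ?_ ?_ ?_ ?_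
  · intro S hS
    unfold cubeStateSet at hS
    rw [Finset.mem_filter] at hS
    unfold FZone.AsetF
    rw [Finset.mem_filter]
    exact ⟨Finset.mem_univ _, (skel_isCubeState_iff O S hc hne).1 hS.2⟩
  · intro σ hσ
    unfold FZone.AsetF at hσ
    rw [Finset.mem_filter] at hσ
    unfold cubeStateSet
    rw [Finset.mem_filter]
    refine ⟨Finset.mem_univ _, ?_⟩
    rw [skel_isCubeState_iff O _ hc hne, toState_ofState hne σ]
    exact hσ.2
  · intro S _
    exact ofState_toState S
  · intro σ _
    exact toState_ofState hne σ
  · intro S hS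
    unfold cubeStateSet at hS
    rw [Finset.mem_filter] at hS
    by_cases hinv : G.RcInvalid a b c S
    · rw [if_neg (not_not.2 hinv), ocWeight_eq_zero_of_invalid hc O S hab hS.2 hinv]
    · rw [if_pos hinv]
      exact gdWeight_eq_ocWeight hc O S hab hS.2 hinv

open Classical in
/-- **CONJECTURE (O-CUBE) IS THE ZONE O-CUBE CONJECTURE ON THE SKELETON ZONES**: for a skeleton with `c` a
non-terminal, distinct terminals and an edge between them, `OCubeConj a b c` holds iff the ZONE O-CUBE conjecture holds
on `skelZone a b O` with anchor `c` and protected anchor `c` for every bare colouring `O`. -/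
theorem oCubeConj_iff_zoneOCube :
    G.OCubeConj a b c ↔ ∀ O : Config E, (G.skelZone a b O).ZoneOCubeConjF {c} {c} := by
  unfold OCubeConj FZone.ZoneOCubeConjF
  constructor
  · intro h O
    rw [← oCube_eq_zoneOCubeF hc hne hab O]
    exact h O
  · intro h O
    rw [oCube_eq_zoneOCubeF hc hne hab O]
    exact h O

end Sums

end MultiGraph

end PercRepro
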